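import Literature.Computability.QuantumComplexity.OversamplingClosure
import Literature.Computability.QuantumComplexity.InnerProductEstimation
import HarnessLib

/-!
# Trace inner products and expectation values from `SQ_φ(A)` (CGLLTW 2022, §3.2 Remark 3.2)

Chia, Gilyén, Li, Lin, Tang, Wang, J. ACM 69(5):33 (2022) = arXiv:1910.06151, **§3.2 Remark 3.2**
(held arXiv text p. 19 L45–64), immediately after the Lemma "Inner product estimation"
([Tang 2019]; in tree as `SampleQuery.innerProductEstimation`):

> **Remark 3.2.** (Lemma: inner product estimation) also applies to higher-order tensor inner
> products:
> (a) (Trace inner products, [GLT18]) Given `SQ_φ(A) ∈ ℂ^{n×n}` and `Q(B) ∈ ℂ^{n×n}`, we can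
>     estimate `tr[AB†]` to additive error `ε` with probability at least `1−δ` by using
>     `O(φ ‖A‖_F²‖B‖_F² ε⁻² (sq_φ(A) + q(B)) log(1/δ))` time. To do this, note that `SQ_φ(A)` and
>     `Q(B)` imply `SQ_φ(vec(A))` and `Q(vec(B))`. `tr[AB†] = ⟨vec(B), vec(A)⟩`, so we can just
>     apply (Lemma: inner product estimation) to conclude.
> (b) (Expectation values) Given `SQ_φ(A) ∈ ℂ^{n×n}` and `Q(x), Q(y) ∈ ℂⁿ`, we can estimate `x†Ay`
>     to additive error `ε` with probability at least `1−δ` in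
>     `O(‖A‖_F²‖x‖²‖y‖² ε⁻² (sq_φ(A) + q(x) + q(y)) log(1/δ))` time. To do this, observe that
>     `x†Ay = tr(x†Ay) = tr(Ayx†)` and that `Q(yx†)` can be simulated with `Q(x), Q(y)`. So, we just
>     apply the trace inner product procedure.

This file formalizes both items in the tree's finite-probability language (real entries, rectangular
`A ∈ ℝ^{m×n}` — the square case printed is `m = n`):

* `vecOf A ∈ ℝ^{mn}` (row-major vectorisation), `normSq_vecOf` (`‖vec A‖² = ‖A‖_F²`),
  `sum_vecOf_mul_vecOf` / `trace_mul_transpose` (`⟨vec A, vec B⟩ = Σ_ij A_ij B_ij = tr(ABᵀ)`),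
  `lengthSqDist_vecOf` (`𝒟_{vec Ã}(i,j) = 𝒟_ã(i)·𝒟_{Ã(i,·)}(j)`: the two-stage `SQ(Ã)` sample IS a
  sample from `vec Ã`), and `MatrixOversamplingWitness.vec : SQ_φ(A) → SQ_φ(vec A)` with witness
  `vec Ã` ("`SQ_φ(A)` and `Q(B)` imply `SQ_φ(vec(A))` and `Q(vec(B))`");
* `traceInnerProductEstimation` — (a): the median-of-means inner-product estimator run on
  `(vec Ã, vec A; vec B)` with `x ≥ 8φ‖A‖_F²‖B‖_F²/ε²` samples per block and `q ≥ 8 ln(1/δ)` blocks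
  is `ε`-close to `tr(ABᵀ)` except on outcomes of total `𝒟_{vec Ã}`-weight `≤ δ`;
* `expectationValueEstimation` — (b): the same with `B = xyᵀ` (`‖xyᵀ‖_F² = ‖x‖²‖y‖²`,
  `tr(A(xyᵀ)ᵀ) = xᵀAy`), `x ≥ 8φ‖A‖_F²‖x‖²‖y‖²/ε²`.

Sample counts are those of the tree's `innerProductEstimation` (`x·q = O(φ‖u‖²‖v‖²ε⁻² log(1/δ))`),
matching the printed bounds (item (b) is printed without the factor `φ`, which item (a) — to which
(b) reduces — carries).  No named facts are introduced; everything stated is proved.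

## References
* [ChiaEtAl2022] N.-H. Chia, A. Gilyén, T. Li, H.-H. Lin, E. Tang, C. Wang, J. ACM 69(5):33, 2022
  (= arXiv:1910.06151), §3.2 Remark 3.2 (a), (b); §2.2 remark after Def. 2.9 (`SQ(A)` gives
  `SQ(vec A)`).
* [TangEwin2019] E. Tang, STOC 2019, Prop. 4.2 — via `InnerProductEstimation`.
* [GLT18] A. Gilyén, S. Lloyd, E. Tang, arXiv:1811.04909 (the trace inner product trick), as
  cited by [ChiaEtAl2022].
-/

noncomputable section

open scoped Matrix

namespace Literature.Computability.QuantumComplexity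

namespace SampleQuery

open Finset Literature.Computability.Complexity

variable {m n : ℕ} {φ : ℝ} {A : Matrix (Fin m) (Fin n) ℝ}

/-! ### `vec(A)` and `SQ_φ(vec A)` from `SQ_φ(A)` -/

/-- `vec(A) ∈ ℝ^{mn}`: the entries of `A` listed row by row (`(i,j) ↦ finProdFinEquiv (i,j)`).
[cite: ChiaEtAl2022, §3.2 Remark 3.2 (a) ("`SQ_φ(A)` and `Q(B)` imply `SQ_φ(vec(A))` and
`Q(vec(B))`")] -/
def vecOf (A : Matrix (Fin m) (Fin n) ℝ) : Fin (m * n) → ℝ :=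
  fun t => A (finProdFinEquiv.symm t).1 (finProdFinEquiv.symm t).2

/-- `vec(A)` at the position of `(i,j)` is `A(i,j)`. [cite: ChiaEtAl2022, §3.2 Remark 3.2 (a)] -/
@[simp] theorem vecOf_finProdFinEquiv (A : Matrix (Fin m) (Fin n) ℝ) (i : Fin m) (j : Fin n) :
    vecOf A (finProdFinEquiv (i, j)) = A i j := by
  simp [vecOf]

/-- Sums over `[mn]` are double sums over `[m] × [n]`. `[folklore]` (private plumbing) -/
private theorem sum_finProd (F : Fin (m * n) → ℝ) :
    ∑ t, F t = ∑ i : Fin m, ∑ j : Fin n, F (finProdFinEquiv (i, j)) := by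
  rw [← Fintype.sum_prod_type (f := fun p : Fin m × Fin n => F (finProdFinEquiv p))]
  exact (Fintype.sum_equiv finProdFinEquiv (fun p => F (finProdFinEquiv p)) F fun _ => rfl).symm

/-- `‖vec A‖² = ‖A‖_F²`. [cite: ChiaEtAl2022, §3.2 Remark 3.2 (a) (the cost `‖A‖_F²‖B‖_F²` is
`‖vec A‖²‖vec B‖²` of the inner-product lemma)] -/
theorem normSq_vecOf (A : Matrix (Fin m) (Fin n) ℝ) : normSq (vecOf A) = frobSq A := by
  unfold normSq
  rw [sum_finProd, frobSq_eq_sum_sq]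
  simp only [vecOf_finProdFinEquiv]

/-- `⟨vec A, vec B⟩ = Σ_{i,j} A(i,j) B(i,j)`. [cite: ChiaEtAl2022, §3.2 Remark 3.2 (a)
("`tr[AB†] = ⟨vec(B), vec(A)⟩`")] -/
theorem sum_vecOf_mul_vecOf (A B : Matrix (Fin m) (Fin n) ℝ) :
    ∑ t, vecOf A t * vecOf B t = ∑ i, ∑ j, A i j * B i j := by
  rw [sum_finProd]
  simp only [vecOf_finProdFinEquiv]

/-- `tr(ABᵀ) = Σ_{i,j} A(i,j) B(i,j)` (real case of `tr[AB†]`). [cite: ChiaEtAl2022, §3.2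
Remark 3.2 (a)] -/
theorem trace_mul_transpose (A B : Matrix (Fin m) (Fin n) ℝ) :
    (A * Bᵀ).trace = ∑ i, ∑ j, A i j * B i j := by
  simp only [Matrix.trace, Matrix.diag_apply, Matrix.mul_apply, Matrix.transpose_apply]

/-- `A ≠ 0 ⇒ vec A ≠ 0`. `[folklore]` (private plumbing) -/
private theorem vecOf_ne_zero (hA : A ≠ 0) : vecOf A ≠ 0 := by
  intro h
  apply hA
  ext i j
  have := congr_fun h (finProdFinEquiv (i, j))
  simpa only [vecOf_finProdFinEquiv, Pi.zero_apply, Matrix.zero_apply] using this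

/-- The law of `vec Ã` factors as the two-stage `SQ(Ã)` sample: `𝒟_{vec Ã}(i,j) =
𝒟_ã(i) · 𝒟_{Ã(i,·)}(j)` (row `i` from the row-norm vector, then entry `j` from row `i`).
[cite: ChiaEtAl2022, §2.2 remark after Def. 2.9 ("`SQ(A)` implies `SQ(vec A)`: sample `i ∼ 𝒟_a`,
then `j ∼ 𝒟_{A(i,·)}`") and §3.2 Remark 3.2 (a)] -/
theorem lengthSqDist_vecOf (A : Matrix (Fin m) (Fin n) ℝ) (i : Fin m) (j : Fin n) :
    lengthSqDist (vecOf A) (finProdFinEquiv (i, j)) = rowDist A i * lengthSqDist (A i) j := by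
  rw [rowDist_mul_lengthSqDist]
  unfold lengthSqDist
  rw [normSq_vecOf, vecOf_finProdFinEquiv]

namespace MatrixOversamplingWitness

/-- **`SQ_φ(A)` gives `SQ_φ(vec A)`** with witness `vec Ã`: `‖vec Ã‖² = ‖Ã‖_F² = φ‖A‖_F² =
φ‖vec A‖²` and entrywise domination is inherited. [cite: ChiaEtAl2022, §3.2 Remark 3.2 (a)
("`SQ_φ(A)` and `Q(B)` imply `SQ_φ(vec(A))` and `Q(vec(B))`")] -/
def vec (W : MatrixOversamplingWitness φ A) : OversamplingWitness φ (vecOf A) where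
  tilde := vecOf W.tilde
  normSq_tilde := by rw [normSq_vecOf, normSq_vecOf, W.frobSq_tilde]
  sq_le t := W.sq_le _ _

/-- The witness of `SQ_φ(vec A)` is `vec Ã`. [cite: ChiaEtAl2022, §3.2 Remark 3.2 (a)] -/
@[simp] theorem vec_tilde (W : MatrixOversamplingWitness φ A) : W.vec.tilde = vecOf W.tilde := rfl

end MatrixOversamplingWitness

/-! ### Remark 3.2 (a): trace inner products -/

/-- **Trace inner product estimation** (CGLLTW Remark 3.2 (a), real case): given `SQ_φ(A)`
(`A ≠ 0`, witness `Ã`) and query access to `B ∈ ℝ^{m×n}`, run the median-of-means inner-product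
estimator on `u = vec A` (samples `t ∼ 𝒟_{vec Ã}`, single-sample value
`‖Ã‖_F² A(t)B(t)/Ã(t)²`) with `q` blocks of `x` samples, `x ≥ 8φ‖A‖_F²‖B‖_F²/ε²`,
`q ≥ 8 ln(1/δ)`, and output any median of the block means: the outcomes on which the output is
`ε`-far from `tr(ABᵀ)` have total weight `≤ δ`.
[cite: ChiaEtAl2022, §3.2 Remark 3.2 (a) ("estimate `tr[AB†]` to additive error `ε` with
probability at least `1−δ` by using `O(φ‖A‖_F²‖B‖_F² ε⁻² … log(1/δ))` time … `tr[AB†] =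
⟨vec(B), vec(A)⟩`, so we can just apply (inner product estimation)")] -/
theorem traceInnerProductEstimation (W : MatrixOversamplingWitness φ A) (hA : A ≠ 0)
    (B : Matrix (Fin m) (Fin n) ℝ) {x q : ℕ} (hx : 0 < x) (hq : 0 < q) {ε δ : ℝ} (hε : 0 < ε)
    (hδ : 0 < δ) (hxε : 8 * φ * frobSq A * frobSq B / ε ^ 2 ≤ x) (hqδ : 8 * Real.log (1 / δ) ≤ q)
    (med : (Fin q → Fin x → Fin (m * n)) → ℝ)
    (hmed : ∀ ω, IsMedian (fun i => ipBlockMean W.vec (vecOf B) (ω i)) (med ω)) :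
    ∑ ω ∈ univ.filter (fun ω : Fin q → Fin x → Fin (m * n) => ε ≤ |med ω - (A * Bᵀ).trace|),
        ∏ i, iidWeight (lengthSqDist (vecOf W.tilde)) (ω i) ≤ δ := by
  have hxε' : 8 * φ * normSq (vecOf A) * normSq (vecOf B) / ε ^ 2 ≤ x := by
    rwa [normSq_vecOf, normSq_vecOf]
  have h := innerProductEstimation W.vec (vecOf_ne_zero hA) (vecOf B) hx hq hε hδ hxε' hqδ med hmed
  have e : (A * Bᵀ).trace = ∑ t, vecOf A t * vecOf B t := by
    rw [trace_mul_transpose, sum_vecOf_mul_vecOf]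
  simp_rw [e]
  exact h

/-- The same with the median selector supplied (`q > 0` blocks always have a median), so the
procedure is well defined on every outcome. [cite: ChiaEtAl2022, §3.2 Remark 3.2 (a)] -/
theorem traceInnerProductEstimation_exists_median (W : MatrixOversamplingWitness φ A) (hA : A ≠ 0)
    (B : Matrix (Fin m) (Fin n) ℝ) {x q : ℕ} (hx : 0 < x) (hq : 0 < q) {ε δ : ℝ} (hε : 0 < ε)
    (hδ : 0 < δ) (hxε : 8 * φ * frobSq A * frobSq B / ε ^ 2 ≤ x) (hqδ : 8 * Real.log (1 / δ) ≤ q) :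
    ∃ med : (Fin q → Fin x → Fin (m * n)) → ℝ,
      (∀ ω, IsMedian (fun i => ipBlockMean W.vec (vecOf B) (ω i)) (med ω)) ∧
      ∑ ω ∈ univ.filter (fun ω : Fin q → Fin x → Fin (m * n) => ε ≤ |med ω - (A * Bᵀ).trace|),
        ∏ i, iidWeight (lengthSqDist (vecOf W.tilde)) (ω i) ≤ δ := by
  classical
  have hsel : ∀ ω : Fin q → Fin x → Fin (m * n),
      ∃ c, IsMedian (fun i => ipBlockMean W.vec (vecOf B) (ω i)) c := fun ω => by
    obtain ⟨i, hi⟩ := exists_isMedian hq (fun i => ipBlockMean W.vec (vecOf B) (ω i))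
    exact ⟨_, hi⟩
  choose med hmed using hsel
  exact ⟨med, hmed, traceInnerProductEstimation W hA B hx hq hε hδ hxε hqδ med hmed⟩

/-! ### Remark 3.2 (b): expectation values `xᵀAy` -/

/-- `tr(A (x yᵀ)ᵀ) = xᵀ A y` (real case of "`x†Ay = tr(x†Ay) = tr(Ayx†)`").
[cite: ChiaEtAl2022, §3.2 Remark 3.2 (b)] -/
theorem trace_mul_transpose_vecMulVec (A : Matrix (Fin m) (Fin n) ℝ) (u : Fin m → ℝ)
    (v : Fin n → ℝ) : (A * (Matrix.vecMulVec u v)ᵀ).trace = u ⬝ᵥ (A *ᵥ v) := by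
  rw [trace_mul_transpose]
  simp only [dotProduct, Matrix.mulVec, Matrix.vecMulVec_apply, mul_sum]
  refine sum_congr rfl fun i _ => sum_congr rfl fun j _ => ?_
  ring

/-- **Expectation value estimation** (CGLLTW Remark 3.2 (b), real case): given `SQ_φ(A)`
(`A ≠ 0`) and query access to `x ∈ ℝᵐ`, `y ∈ ℝⁿ`, the trace-inner-product estimator for
`B = xyᵀ` (whose entries `x(i)y(j)` are queries to `x` and `y`) with `q` blocks of
`s ≥ 8φ‖A‖_F²‖x‖²‖y‖²/ε²` samples, `q ≥ 8 ln(1/δ)`, outputs a value `ε`-close to `xᵀAy` except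
on outcomes of total weight `≤ δ`.
[cite: ChiaEtAl2022, §3.2 Remark 3.2 (b) ("estimate `x†Ay` to additive error `ε` with probability
at least `1−δ` in `O(‖A‖_F²‖x‖²‖y‖² ε⁻² … log(1/δ))` time … `x†Ay = tr(Ayx†)` and `Q(yx†)` can be
simulated with `Q(x), Q(y)`. So, we just apply the trace inner product procedure")] -/
theorem expectationValueEstimation (W : MatrixOversamplingWitness φ A) (hA : A ≠ 0)
    (u : Fin m → ℝ) (v : Fin n → ℝ) {s q : ℕ} (hs : 0 < s) (hq : 0 < q) {ε δ : ℝ} (hε : 0 < ε)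
    (hδ : 0 < δ) (hsε : 8 * φ * frobSq A * (normSq u * normSq v) / ε ^ 2 ≤ s)
    (hqδ : 8 * Real.log (1 / δ) ≤ q) (med : (Fin q → Fin s → Fin (m * n)) → ℝ)
    (hmed : ∀ ω, IsMedian (fun i => ipBlockMean W.vec (vecOf (Matrix.vecMulVec u v)) (ω i))
      (med ω)) :
    ∑ ω ∈ univ.filter (fun ω : Fin q → Fin s → Fin (m * n) => ε ≤ |med ω - u ⬝ᵥ (A *ᵥ v)|),
        ∏ i, iidWeight (lengthSqDist (vecOf W.tilde)) (ω i) ≤ δ := by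
  have hsε' : 8 * φ * frobSq A * frobSq (Matrix.vecMulVec u v) / ε ^ 2 ≤ s := by
    rwa [frobSq_vecMulVec]
  have h := traceInnerProductEstimation W hA (Matrix.vecMulVec u v) hs hq hε hδ hsε' hqδ med hmed
  simp_rw [trace_mul_transpose_vecMulVec] at h
  exact h

end SampleQuery

end Literature.Computability.QuantumComplexity

end
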